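import Summits.Ventures.PercRepro.C025ProfileLevelInj
import Summits.Ventures.PercRepro.C025ProfileTwoFlatPLDLemmas

/-!
# PER-LAYER DOMINANCE ON TWO UNIFORM FLATS — THE MOVES (night-3 g27)

`proofs/NIGHT3-G27-PLD.md` §4.  The data of `C025ProfileTwoFlatPLD`: flats `F₁, F₂` with ranks `s₁, s₂` and selectors
`J₁, J₂`; the residual sources `RS` (given by `hRS`); level-raising injections `φ₁ S i j`, `φ₂ S i j` (level `i → j` of
`B(S)`, injective with `I ⊆ φ I` whenever `i ≤ j`, `i + j ≤ #S` — from `C025ProfileLevelInj`).  The moves of the injection,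
spelled out: for a source overflowing on flat 1 the absorber `YS₁ σ = φ₂ (F₂ ∖ D₂) #I₂ (#I₂ + o) I₂`, `o = c₁ + δ₁ − f₁`,
and `YL₁ σ` at level `#I₂ + o'`, `o' = c₁ + δ₁ − s₁` (symmetrically `YS₂, YL₂`); the images `N σ`, `S₁ σ`, `L₁ σ`, `S₂ σ`,
`L₂ σ`; the crossed pair `C₁ σ = (F₁ ∖ I₁ ∖ D₁ ⊔ YS₁ σ, D)` whose being a non-overflowing residual source BLOCKS the S-move.
This module: the absorber facts (`absorb_S₁` …: `Y ⊆ F_p ∖ D_p`, its size, `I_p ⊆ Y`, the Hall bound), the blocked facts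
(`blocked_facts₁` …), and the injectivity pairs involving an N-image or an S/L pair on the same flat
(`N_eq_N`, `N_ne_S₁`, `N_ne_S₂`, `N_ne_L₁`, `N_ne_L₂`, `S₁_ne_L₁`, `S₂_ne_L₂`).  No `def`, no `instance`, no notation.
Axioms: standard.
-/

namespace PercRepro

namespace TwoFlatPLD

open Finset

variable {α β : Type} [DecidableEq α] [DecidableEq β]

/-- **Absorber facts** (S-move, overflow on flat 1): for a residual source overflowing on flat 1, the
absorber lies in `F₂ ∖ D`, has size `#I + o`, contains `I`, and the Hall bound holds. -/
theorem absorb_S₁ (F₁ : Finset α) (F₂ : Finset β) (s₁ s₂ : ℕ) (J₁ : Finset α → Finset α) (J₂ : Finset β → Finset β)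
    (hJ₂ : ∀ X, J₂ X ⊆ X) (lo hi δ : ℕ)
    (RS : Finset ((Finset α × Finset α) × (Finset β × Finset β)))
    (hRS : ∀ σ : (Finset α × Finset α) × (Finset β × Finset β), σ ∈ RS ↔ σ.1.1 ⊆ F₁ ∧ σ.2.1 ⊆ F₂ ∧
      σ.1.2 ⊆ J₁ (F₁ \ σ.1.1) ∧ σ.2.2 ⊆ J₂ (F₂ \ σ.2.1) ∧
      σ.1.2.card + σ.2.2.card = δ ∧ lo ≤ min σ.1.1.card s₁ + min σ.2.1.card s₂ ∧
      min σ.1.1.card s₁ + min σ.2.1.card s₂ ≤ hi ∧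
      hi + δ + 1 ≤ min (F₁.card - σ.1.1.card) s₁ + min (F₂.card - σ.2.1.card) s₂)
    (φ₂ : Finset β → ℕ → ℕ → Finset β → Finset β)
    (hφ₂ : ∀ (S : Finset β) (i j : ℕ), i ≤ j → i + j ≤ S.card →
      (Set.InjOn (φ₂ S i j) (S.powersetCard i) ∧ ∀ I ∈ S.powersetCard i, φ₂ S i j I ∈ S.powersetCard j ∧ I ⊆ φ₂ S i j I))
    (σ : (Finset α × Finset α) × (Finset β × Finset β)) (hσ : σ ∈ RS) (hov : s₁ < min σ.1.1.card s₁ + σ.1.2.card) :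
    φ₂ (F₂ \ σ.2.2) σ.2.1.card (σ.2.1.card + (min σ.1.1.card s₁ + σ.1.2.card - min (F₁.card - σ.1.1.card) s₁)) σ.2.1 ⊆ F₂ \ σ.2.2 ∧ (φ₂ (F₂ \ σ.2.2) σ.2.1.card (σ.2.1.card + (min σ.1.1.card s₁ + σ.1.2.card - min (F₁.card - σ.1.1.card) s₁)) σ.2.1).card = σ.2.1.card + (min σ.1.1.card s₁ + σ.1.2.card - min (F₁.card - σ.1.1.card) s₁) ∧ σ.2.1 ⊆ φ₂ (F₂ \ σ.2.2) σ.2.1.card (σ.2.1.card + (min σ.1.1.card s₁ + σ.1.2.card - min (F₁.card - σ.1.1.card) s₁)) σ.2.1 ∧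
      σ.2.1.card + (σ.2.1.card + (min σ.1.1.card s₁ + σ.1.2.card - min (F₁.card - σ.1.1.card) s₁)) ≤ (F₂ \ σ.2.2).card ∧ σ.2.1 ∈ (F₂ \ σ.2.2).powersetCard σ.2.1.card := by
  obtain ⟨hI₁, hI₂, hD₁, hD₂, hδ, hlo, hhi, hf⟩ := (hRS σ).1 hσ
  have hDpF : σ.2.2 ⊆ F₂ \ σ.2.1 := hD₂.trans (hJ₂ _)
  obtain ⟨r1, r2, r3, r4⟩ := residual_facts (k_o := F₁.card) (i_o := σ.1.1.card) (s_o := s₁)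
    (δ_o := σ.1.2.card) (k_p := F₂.card) (i_p := σ.2.1.card) (s_p := s₂) (δ_p := σ.2.2.card)
    (hi := hi) (δ := δ) (by omega) (by omega) (by omega) hov (card_le_card hI₁) (card_le_card hI₂)
  have hImem : σ.2.1 ∈ (F₂ \ σ.2.2).powersetCard σ.2.1.card := by
    rw [mem_powersetCard]
    refine ⟨?_, rfl⟩
    intro x hx
    rw [mem_sdiff]
    exact ⟨hI₂ hx, fun hxD => (mem_sdiff.1 (hDpF hxD)).2 hx⟩
  have hcardS : (F₂ \ σ.2.2).card = F₂.card - σ.2.2.card := card_sdiff_of_subset (hDpF.trans sdiff_subset)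
  have hhall : σ.2.1.card + (σ.2.1.card + (min σ.1.1.card s₁ + σ.1.2.card - min (F₁.card - σ.1.1.card) s₁)) ≤ (F₂ \ σ.2.2).card := by
    rw [hcardS]; omega
  have hH := hφ₂ (F₂ \ σ.2.2) σ.2.1.card (σ.2.1.card + (min σ.1.1.card s₁ + σ.1.2.card - min (F₁.card - σ.1.1.card) s₁)) (by omega) hhall
  obtain ⟨hmem, hsub⟩ := hH.2 σ.2.1 hImem
  rw [mem_powersetCard] at hmem
  exact ⟨hmem.1, hmem.2, hsub, hhall, hImem⟩

/-- **Absorber facts** (L-move, overflow on flat 1): for a residual source overflowing on flat 1, the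
absorber lies in `F₂ ∖ D`, has size `#I + o'`, contains `I`, and the Hall bound holds. -/
theorem absorb_L₁ (F₁ : Finset α) (F₂ : Finset β) (s₁ s₂ : ℕ) (J₁ : Finset α → Finset α) (J₂ : Finset β → Finset β)
    (hJ₂ : ∀ X, J₂ X ⊆ X) (lo hi δ : ℕ)
    (RS : Finset ((Finset α × Finset α) × (Finset β × Finset β)))
    (hRS : ∀ σ : (Finset α × Finset α) × (Finset β × Finset β), σ ∈ RS ↔ σ.1.1 ⊆ F₁ ∧ σ.2.1 ⊆ F₂ ∧
      σ.1.2 ⊆ J₁ (F₁ \ σ.1.1) ∧ σ.2.2 ⊆ J₂ (F₂ \ σ.2.1) ∧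
      σ.1.2.card + σ.2.2.card = δ ∧ lo ≤ min σ.1.1.card s₁ + min σ.2.1.card s₂ ∧
      min σ.1.1.card s₁ + min σ.2.1.card s₂ ≤ hi ∧
      hi + δ + 1 ≤ min (F₁.card - σ.1.1.card) s₁ + min (F₂.card - σ.2.1.card) s₂)
    (φ₂ : Finset β → ℕ → ℕ → Finset β → Finset β)
    (hφ₂ : ∀ (S : Finset β) (i j : ℕ), i ≤ j → i + j ≤ S.card →
      (Set.InjOn (φ₂ S i j) (S.powersetCard i) ∧ ∀ I ∈ S.powersetCard i, φ₂ S i j I ∈ S.powersetCard j ∧ I ⊆ φ₂ S i j I))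
    (σ : (Finset α × Finset α) × (Finset β × Finset β)) (hσ : σ ∈ RS) (hov : s₁ < min σ.1.1.card s₁ + σ.1.2.card) :
    φ₂ (F₂ \ σ.2.2) σ.2.1.card (σ.2.1.card + (min σ.1.1.card s₁ + σ.1.2.card - s₁)) σ.2.1 ⊆ F₂ \ σ.2.2 ∧ (φ₂ (F₂ \ σ.2.2) σ.2.1.card (σ.2.1.card + (min σ.1.1.card s₁ + σ.1.2.card - s₁)) σ.2.1).card = σ.2.1.card + (min σ.1.1.card s₁ + σ.1.2.card - s₁) ∧ σ.2.1 ⊆ φ₂ (F₂ \ σ.2.2) σ.2.1.card (σ.2.1.card + (min σ.1.1.card s₁ + σ.1.2.card - s₁)) σ.2.1 ∧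
      σ.2.1.card + (σ.2.1.card + (min σ.1.1.card s₁ + σ.1.2.card - s₁)) ≤ (F₂ \ σ.2.2).card ∧ σ.2.1 ∈ (F₂ \ σ.2.2).powersetCard σ.2.1.card := by
  obtain ⟨hI₁, hI₂, hD₁, hD₂, hδ, hlo, hhi, hf⟩ := (hRS σ).1 hσ
  have hDpF : σ.2.2 ⊆ F₂ \ σ.2.1 := hD₂.trans (hJ₂ _)
  obtain ⟨r1, r2, r3, r4⟩ := residual_facts (k_o := F₁.card) (i_o := σ.1.1.card) (s_o := s₁)
    (δ_o := σ.1.2.card) (k_p := F₂.card) (i_p := σ.2.1.card) (s_p := s₂) (δ_p := σ.2.2.card)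
    (hi := hi) (δ := δ) (by omega) (by omega) (by omega) hov (card_le_card hI₁) (card_le_card hI₂)
  have hImem : σ.2.1 ∈ (F₂ \ σ.2.2).powersetCard σ.2.1.card := by
    rw [mem_powersetCard]
    refine ⟨?_, rfl⟩
    intro x hx
    rw [mem_sdiff]
    exact ⟨hI₂ hx, fun hxD => (mem_sdiff.1 (hDpF hxD)).2 hx⟩
  have hcardS : (F₂ \ σ.2.2).card = F₂.card - σ.2.2.card := card_sdiff_of_subset (hDpF.trans sdiff_subset)
  have hhall : σ.2.1.card + (σ.2.1.card + (min σ.1.1.card s₁ + σ.1.2.card - s₁)) ≤ (F₂ \ σ.2.2).card := by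
    rw [hcardS]; omega
  have hH := hφ₂ (F₂ \ σ.2.2) σ.2.1.card (σ.2.1.card + (min σ.1.1.card s₁ + σ.1.2.card - s₁)) (by omega) hhall
  obtain ⟨hmem, hsub⟩ := hH.2 σ.2.1 hImem
  rw [mem_powersetCard] at hmem
  exact ⟨hmem.1, hmem.2, hsub, hhall, hImem⟩

/-- **Absorber facts** (S-move, overflow on flat 2): for a residual source overflowing on flat 2, the
absorber lies in `F₁ ∖ D`, has size `#I + o`, contains `I`, and the Hall bound holds. -/
theorem absorb_S₂ (F₁ : Finset α) (F₂ : Finset β) (s₁ s₂ : ℕ) (J₁ : Finset α → Finset α) (J₂ : Finset β → Finset β)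
    (hJ₁ : ∀ X, J₁ X ⊆ X) (lo hi δ : ℕ)
    (RS : Finset ((Finset α × Finset α) × (Finset β × Finset β)))
    (hRS : ∀ σ : (Finset α × Finset α) × (Finset β × Finset β), σ ∈ RS ↔ σ.1.1 ⊆ F₁ ∧ σ.2.1 ⊆ F₂ ∧
      σ.1.2 ⊆ J₁ (F₁ \ σ.1.1) ∧ σ.2.2 ⊆ J₂ (F₂ \ σ.2.1) ∧
      σ.1.2.card + σ.2.2.card = δ ∧ lo ≤ min σ.1.1.card s₁ + min σ.2.1.card s₂ ∧
      min σ.1.1.card s₁ + min σ.2.1.card s₂ ≤ hi ∧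
      hi + δ + 1 ≤ min (F₁.card - σ.1.1.card) s₁ + min (F₂.card - σ.2.1.card) s₂)
    (φ₁ : Finset α → ℕ → ℕ → Finset α → Finset α)
    (hφ₁ : ∀ (S : Finset α) (i j : ℕ), i ≤ j → i + j ≤ S.card →
      (Set.InjOn (φ₁ S i j) (S.powersetCard i) ∧ ∀ I ∈ S.powersetCard i, φ₁ S i j I ∈ S.powersetCard j ∧ I ⊆ φ₁ S i j I))
    (σ : (Finset α × Finset α) × (Finset β × Finset β)) (hσ : σ ∈ RS) (hov : s₂ < min σ.2.1.card s₂ + σ.2.2.card) :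
    φ₁ (F₁ \ σ.1.2) σ.1.1.card (σ.1.1.card + (min σ.2.1.card s₂ + σ.2.2.card - min (F₂.card - σ.2.1.card) s₂)) σ.1.1 ⊆ F₁ \ σ.1.2 ∧ (φ₁ (F₁ \ σ.1.2) σ.1.1.card (σ.1.1.card + (min σ.2.1.card s₂ + σ.2.2.card - min (F₂.card - σ.2.1.card) s₂)) σ.1.1).card = σ.1.1.card + (min σ.2.1.card s₂ + σ.2.2.card - min (F₂.card - σ.2.1.card) s₂) ∧ σ.1.1 ⊆ φ₁ (F₁ \ σ.1.2) σ.1.1.card (σ.1.1.card + (min σ.2.1.card s₂ + σ.2.2.card - min (F₂.card - σ.2.1.card) s₂)) σ.1.1 ∧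
      σ.1.1.card + (σ.1.1.card + (min σ.2.1.card s₂ + σ.2.2.card - min (F₂.card - σ.2.1.card) s₂)) ≤ (F₁ \ σ.1.2).card ∧ σ.1.1 ∈ (F₁ \ σ.1.2).powersetCard σ.1.1.card := by
  obtain ⟨hI₁, hI₂, hD₁, hD₂, hδ, hlo, hhi, hf⟩ := (hRS σ).1 hσ
  have hDpF : σ.1.2 ⊆ F₁ \ σ.1.1 := hD₁.trans (hJ₁ _)
  obtain ⟨r1, r2, r3, r4⟩ := residual_facts (k_o := F₂.card) (i_o := σ.2.1.card) (s_o := s₂)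
    (δ_o := σ.2.2.card) (k_p := F₁.card) (i_p := σ.1.1.card) (s_p := s₁) (δ_p := σ.1.2.card)
    (hi := hi) (δ := δ) (by omega) (by omega) (by omega) hov (card_le_card hI₂) (card_le_card hI₁)
  have hImem : σ.1.1 ∈ (F₁ \ σ.1.2).powersetCard σ.1.1.card := by
    rw [mem_powersetCard]
    refine ⟨?_, rfl⟩
    intro x hx
    rw [mem_sdiff]
    exact ⟨hI₁ hx, fun hxD => (mem_sdiff.1 (hDpF hxD)).2 hx⟩
  have hcardS : (F₁ \ σ.1.2).card = F₁.card - σ.1.2.card := card_sdiff_of_subset (hDpF.trans sdiff_subset)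
  have hhall : σ.1.1.card + (σ.1.1.card + (min σ.2.1.card s₂ + σ.2.2.card - min (F₂.card - σ.2.1.card) s₂)) ≤ (F₁ \ σ.1.2).card := by
    rw [hcardS]; omega
  have hH := hφ₁ (F₁ \ σ.1.2) σ.1.1.card (σ.1.1.card + (min σ.2.1.card s₂ + σ.2.2.card - min (F₂.card - σ.2.1.card) s₂)) (by omega) hhall
  obtain ⟨hmem, hsub⟩ := hH.2 σ.1.1 hImem
  rw [mem_powersetCard] at hmem
  exact ⟨hmem.1, hmem.2, hsub, hhall, hImem⟩

/-- **Absorber facts** (L-move, overflow on flat 2): for a residual source overflowing on flat 2, the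
absorber lies in `F₁ ∖ D`, has size `#I + o'`, contains `I`, and the Hall bound holds. -/
theorem absorb_L₂ (F₁ : Finset α) (F₂ : Finset β) (s₁ s₂ : ℕ) (J₁ : Finset α → Finset α) (J₂ : Finset β → Finset β)
    (hJ₁ : ∀ X, J₁ X ⊆ X) (lo hi δ : ℕ)
    (RS : Finset ((Finset α × Finset α) × (Finset β × Finset β)))
    (hRS : ∀ σ : (Finset α × Finset α) × (Finset β × Finset β), σ ∈ RS ↔ σ.1.1 ⊆ F₁ ∧ σ.2.1 ⊆ F₂ ∧
      σ.1.2 ⊆ J₁ (F₁ \ σ.1.1) ∧ σ.2.2 ⊆ J₂ (F₂ \ σ.2.1) ∧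
      σ.1.2.card + σ.2.2.card = δ ∧ lo ≤ min σ.1.1.card s₁ + min σ.2.1.card s₂ ∧
      min σ.1.1.card s₁ + min σ.2.1.card s₂ ≤ hi ∧
      hi + δ + 1 ≤ min (F₁.card - σ.1.1.card) s₁ + min (F₂.card - σ.2.1.card) s₂)
    (φ₁ : Finset α → ℕ → ℕ → Finset α → Finset α)
    (hφ₁ : ∀ (S : Finset α) (i j : ℕ), i ≤ j → i + j ≤ S.card →
      (Set.InjOn (φ₁ S i j) (S.powersetCard i) ∧ ∀ I ∈ S.powersetCard i, φ₁ S i j I ∈ S.powersetCard j ∧ I ⊆ φ₁ S i j I))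
    (σ : (Finset α × Finset α) × (Finset β × Finset β)) (hσ : σ ∈ RS) (hov : s₂ < min σ.2.1.card s₂ + σ.2.2.card) :
    φ₁ (F₁ \ σ.1.2) σ.1.1.card (σ.1.1.card + (min σ.2.1.card s₂ + σ.2.2.card - s₂)) σ.1.1 ⊆ F₁ \ σ.1.2 ∧ (φ₁ (F₁ \ σ.1.2) σ.1.1.card (σ.1.1.card + (min σ.2.1.card s₂ + σ.2.2.card - s₂)) σ.1.1).card = σ.1.1.card + (min σ.2.1.card s₂ + σ.2.2.card - s₂) ∧ σ.1.1 ⊆ φ₁ (F₁ \ σ.1.2) σ.1.1.card (σ.1.1.card + (min σ.2.1.card s₂ + σ.2.2.card - s₂)) σ.1.1 ∧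
      σ.1.1.card + (σ.1.1.card + (min σ.2.1.card s₂ + σ.2.2.card - s₂)) ≤ (F₁ \ σ.1.2).card ∧ σ.1.1 ∈ (F₁ \ σ.1.2).powersetCard σ.1.1.card := by
  obtain ⟨hI₁, hI₂, hD₁, hD₂, hδ, hlo, hhi, hf⟩ := (hRS σ).1 hσ
  have hDpF : σ.1.2 ⊆ F₁ \ σ.1.1 := hD₁.trans (hJ₁ _)
  obtain ⟨r1, r2, r3, r4⟩ := residual_facts (k_o := F₂.card) (i_o := σ.2.1.card) (s_o := s₂)
    (δ_o := σ.2.2.card) (k_p := F₁.card) (i_p := σ.1.1.card) (s_p := s₁) (δ_p := σ.1.2.card)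
    (hi := hi) (δ := δ) (by omega) (by omega) (by omega) hov (card_le_card hI₂) (card_le_card hI₁)
  have hImem : σ.1.1 ∈ (F₁ \ σ.1.2).powersetCard σ.1.1.card := by
    rw [mem_powersetCard]
    refine ⟨?_, rfl⟩
    intro x hx
    rw [mem_sdiff]
    exact ⟨hI₁ hx, fun hxD => (mem_sdiff.1 (hDpF hxD)).2 hx⟩
  have hcardS : (F₁ \ σ.1.2).card = F₁.card - σ.1.2.card := card_sdiff_of_subset (hDpF.trans sdiff_subset)
  have hhall : σ.1.1.card + (σ.1.1.card + (min σ.2.1.card s₂ + σ.2.2.card - s₂)) ≤ (F₁ \ σ.1.2).card := by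
    rw [hcardS]; omega
  have hH := hφ₁ (F₁ \ σ.1.2) σ.1.1.card (σ.1.1.card + (min σ.2.1.card s₂ + σ.2.2.card - s₂)) (by omega) hhall
  obtain ⟨hmem, hsub⟩ := hH.2 σ.1.1 hImem
  rw [mem_powersetCard] at hmem
  exact ⟨hmem.1, hmem.2, hsub, hhall, hImem⟩

/-- **The blocked facts** (overflow on flat 1): if the crossed pair `C₁ σ` is a non-overflowing residual source, then
`#F₁ − #I₁ ≤ s₁`, `D₁ ⊆ J₁ (I₁ ∪ D₁)`, and `C₁ σ` has corank `s₁ + min(#F₂ − #I₂ − o, s₂) ≥ hi + δ + 1`. -/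
theorem blocked_facts₁ (F₁ : Finset α) (F₂ : Finset β) (s₁ s₂ : ℕ) (J₁ : Finset α → Finset α) (J₂ : Finset β → Finset β)
    (hJ₁ : ∀ X, J₁ X ⊆ X) (hJ₂ : ∀ X, J₂ X ⊆ X) (lo hi δ : ℕ)
    (RS : Finset ((Finset α × Finset α) × (Finset β × Finset β)))
    (hRS : ∀ σ : (Finset α × Finset α) × (Finset β × Finset β), σ ∈ RS ↔ σ.1.1 ⊆ F₁ ∧ σ.2.1 ⊆ F₂ ∧
      σ.1.2 ⊆ J₁ (F₁ \ σ.1.1) ∧ σ.2.2 ⊆ J₂ (F₂ \ σ.2.1) ∧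
      σ.1.2.card + σ.2.2.card = δ ∧ lo ≤ min σ.1.1.card s₁ + min σ.2.1.card s₂ ∧
      min σ.1.1.card s₁ + min σ.2.1.card s₂ ≤ hi ∧
      hi + δ + 1 ≤ min (F₁.card - σ.1.1.card) s₁ + min (F₂.card - σ.2.1.card) s₂)
    (φ₂ : Finset β → ℕ → ℕ → Finset β → Finset β)
    (hφ₂ : ∀ (S : Finset β) (i j : ℕ), i ≤ j → i + j ≤ S.card →
      (Set.InjOn (φ₂ S i j) (S.powersetCard i) ∧ ∀ I ∈ S.powersetCard i, φ₂ S i j I ∈ S.powersetCard j ∧ I ⊆ φ₂ S i j I))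
    (σ : (Finset α × Finset α) × (Finset β × Finset β)) (hσ : σ ∈ RS) (hov : s₁ < min σ.1.1.card s₁ + σ.1.2.card)
    (hb : ((((F₁ \ σ.1.1) \ σ.1.2, σ.1.2), (φ₂ (F₂ \ σ.2.2) σ.2.1.card (σ.2.1.card + (min σ.1.1.card s₁ + σ.1.2.card - min (F₁.card - σ.1.1.card) s₁)) σ.2.1, σ.2.2)) ∈ RS ∧ ¬ (s₁ < min ((F₁ \ σ.1.1) \ σ.1.2).card s₁ + σ.1.2.card) ∧ ¬ (s₂ < min (φ₂ (F₂ \ σ.2.2) σ.2.1.card (σ.2.1.card + (min σ.1.1.card s₁ + σ.1.2.card - min (F₁.card - σ.1.1.card) s₁)) σ.2.1).card s₂ + σ.2.2.card))) :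
    F₁.card - σ.1.1.card ≤ s₁ ∧ σ.1.2 ⊆ J₁ (σ.1.1 ∪ σ.1.2) ∧
      hi + δ + 1 ≤ s₁ + min (F₂.card - (σ.2.1.card + (min σ.1.1.card s₁ + σ.1.2.card - min (F₁.card - σ.1.1.card) s₁))) s₂ := by
  obtain ⟨hI₁, hI₂, hD₁, hD₂, hδ, hlo, hhi, hf⟩ := (hRS σ).1 hσ
  have hD₁F : σ.1.2 ⊆ F₁ \ σ.1.1 := hD₁.trans (hJ₁ _)
  obtain ⟨hC, hnov1, hnov2⟩ := hb
  obtain ⟨cI₁, cI₂, cD₁, cD₂, cδ, clo, chi, cf⟩ := (hRS _).1 hC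
  dsimp only at cI₁ cI₂ cD₁ cD₂ cδ clo chi cf
  obtain ⟨y1, y2, y3, -, -⟩ := absorb_S₁ F₁ F₂ s₁ s₂ J₁ J₂ hJ₂ lo hi δ RS hRS φ₂ hφ₂ σ hσ hov
  have hcard_o : ((F₁ \ σ.1.1) \ σ.1.2).card = F₁.card - σ.1.1.card - σ.1.2.card :=
    card_sdiff_sdiff_eq hI₁ hD₁F
  have hcompl_o : F₁ \ ((F₁ \ σ.1.1) \ σ.1.2) = σ.1.1 ∪ σ.1.2 := sdiff_sdiff_sdiff_eq_union hI₁ hD₁F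
  have hDc : σ.1.2.card ≤ F₁.card - σ.1.1.card := by
    have := card_le_card hD₁F
    rwa [card_sdiff_of_subset hI₁] at this
  have hio := card_le_card hI₁
  refine ⟨?_, ?_, ?_⟩
  · rw [hcard_o] at hnov1; omega
  · rwa [hcompl_o] at cD₁
  · rw [hcard_o, y2] at cf
    have : min (F₁.card - (F₁.card - σ.1.1.card - σ.1.2.card)) s₁ = s₁ := by omega
    rw [this] at cf
    exact cf

/-- **The blocked facts** (overflow on flat 2), symmetric to `blocked_facts₁`. -/
theorem blocked_facts₂ (F₁ : Finset α) (F₂ : Finset β) (s₁ s₂ : ℕ) (J₁ : Finset α → Finset α) (J₂ : Finset β → Finset β)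
    (hJ₁ : ∀ X, J₁ X ⊆ X) (hJ₂ : ∀ X, J₂ X ⊆ X) (lo hi δ : ℕ)
    (RS : Finset ((Finset α × Finset α) × (Finset β × Finset β)))
    (hRS : ∀ σ : (Finset α × Finset α) × (Finset β × Finset β), σ ∈ RS ↔ σ.1.1 ⊆ F₁ ∧ σ.2.1 ⊆ F₂ ∧
      σ.1.2 ⊆ J₁ (F₁ \ σ.1.1) ∧ σ.2.2 ⊆ J₂ (F₂ \ σ.2.1) ∧
      σ.1.2.card + σ.2.2.card = δ ∧ lo ≤ min σ.1.1.card s₁ + min σ.2.1.card s₂ ∧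
      min σ.1.1.card s₁ + min σ.2.1.card s₂ ≤ hi ∧
      hi + δ + 1 ≤ min (F₁.card - σ.1.1.card) s₁ + min (F₂.card - σ.2.1.card) s₂)
    (φ₁ : Finset α → ℕ → ℕ → Finset α → Finset α)
    (hφ₁ : ∀ (S : Finset α) (i j : ℕ), i ≤ j → i + j ≤ S.card →
      (Set.InjOn (φ₁ S i j) (S.powersetCard i) ∧ ∀ I ∈ S.powersetCard i, φ₁ S i j I ∈ S.powersetCard j ∧ I ⊆ φ₁ S i j I))
    (σ : (Finset α × Finset α) × (Finset β × Finset β)) (hσ : σ ∈ RS) (hov : s₂ < min σ.2.1.card s₂ + σ.2.2.card)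
    (hb : (((φ₁ (F₁ \ σ.1.2) σ.1.1.card (σ.1.1.card + (min σ.2.1.card s₂ + σ.2.2.card - min (F₂.card - σ.2.1.card) s₂)) σ.1.1, σ.1.2), ((F₂ \ σ.2.1) \ σ.2.2, σ.2.2)) ∈ RS ∧ ¬ (s₁ < min (φ₁ (F₁ \ σ.1.2) σ.1.1.card (σ.1.1.card + (min σ.2.1.card s₂ + σ.2.2.card - min (F₂.card - σ.2.1.card) s₂)) σ.1.1).card s₁ + σ.1.2.card) ∧ ¬ (s₂ < min ((F₂ \ σ.2.1) \ σ.2.2).card s₂ + σ.2.2.card))) :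
    F₂.card - σ.2.1.card ≤ s₂ ∧ σ.2.2 ⊆ J₂ (σ.2.1 ∪ σ.2.2) ∧
      hi + δ + 1 ≤ s₂ + min (F₁.card - (σ.1.1.card + (min σ.2.1.card s₂ + σ.2.2.card - min (F₂.card - σ.2.1.card) s₂))) s₁ := by
  obtain ⟨hI₁, hI₂, hD₁, hD₂, hδ, hlo, hhi, hf⟩ := (hRS σ).1 hσ
  have hD₂F : σ.2.2 ⊆ F₂ \ σ.2.1 := hD₂.trans (hJ₂ _)
  obtain ⟨hC, hnov1, hnov2⟩ := hb
  obtain ⟨cI₁, cI₂, cD₁, cD₂, cδ, clo, chi, cf⟩ := (hRS _).1 hC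
  dsimp only at cI₁ cI₂ cD₁ cD₂ cδ clo chi cf
  obtain ⟨y1, y2, y3, -, -⟩ := absorb_S₂ F₁ F₂ s₁ s₂ J₁ J₂ hJ₁ lo hi δ RS hRS φ₁ hφ₁ σ hσ hov
  have hcard_o : ((F₂ \ σ.2.1) \ σ.2.2).card = F₂.card - σ.2.1.card - σ.2.2.card :=
    card_sdiff_sdiff_eq hI₂ hD₂F
  have hcompl_o : F₂ \ ((F₂ \ σ.2.1) \ σ.2.2) = σ.2.1 ∪ σ.2.2 := sdiff_sdiff_sdiff_eq_union hI₂ hD₂F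
  have hDc : σ.2.2.card ≤ F₂.card - σ.2.1.card := by
    have := card_le_card hD₂F
    rwa [card_sdiff_of_subset hI₂] at this
  have hio := card_le_card hI₂
  refine ⟨?_, ?_, ?_⟩
  · rw [hcard_o] at hnov2; omega
  · rwa [hcompl_o] at cD₂
  · rw [hcard_o, y2] at cf
    have : min (F₂.card - (F₂.card - σ.2.1.card - σ.2.2.card)) s₂ = s₂ := by omega
    rw [this] at cf
    omega

/-- **N vs N**: equal N-images come from equal sources. -/
theorem N_eq_N (F₁ : Finset α) (F₂ : Finset β) (s₁ s₂ : ℕ) (J₁ : Finset α → Finset α) (J₂ : Finset β → Finset β)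
    (hJ₁ : ∀ X, J₁ X ⊆ X) (hJ₂ : ∀ X, J₂ X ⊆ X) (lo hi δ : ℕ)
    (RS : Finset ((Finset α × Finset α) × (Finset β × Finset β)))
    (hRS : ∀ σ : (Finset α × Finset α) × (Finset β × Finset β), σ ∈ RS ↔ σ.1.1 ⊆ F₁ ∧ σ.2.1 ⊆ F₂ ∧
      σ.1.2 ⊆ J₁ (F₁ \ σ.1.1) ∧ σ.2.2 ⊆ J₂ (F₂ \ σ.2.1) ∧
      σ.1.2.card + σ.2.2.card = δ ∧ lo ≤ min σ.1.1.card s₁ + min σ.2.1.card s₂ ∧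
      min σ.1.1.card s₁ + min σ.2.1.card s₂ ≤ hi ∧
      hi + δ + 1 ≤ min (F₁.card - σ.1.1.card) s₁ + min (F₂.card - σ.2.1.card) s₂)
    (σ τ : (Finset α × Finset α) × (Finset β × Finset β)) (hσ : σ ∈ RS) (hτ : τ ∈ RS) (h : (((F₁ \ σ.1.1) \ σ.1.2, σ.1.2), ((F₂ \ σ.2.1) \ σ.2.2, σ.2.2)) = (((F₁ \ τ.1.1) \ τ.1.2, τ.1.2), ((F₂ \ τ.2.1) \ τ.2.2, τ.2.2))) : σ = τ := by
  obtain ⟨sI₁, sI₂, sD₁, sD₂, -, -, -, -⟩ := (hRS σ).1 hσ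
  obtain ⟨tI₁, tI₂, tD₁, tD₂, -, -, -, -⟩ := (hRS τ).1 hτ
  simp only [Prod.mk.injEq] at h
  obtain ⟨⟨e1, e2⟩, ⟨e3, e4⟩⟩ := h
  rw [← e2] at tD₁ e1
  rw [← e4] at tD₂ e3
  have f1 := eq_of_sdiff_sdiff_eq sI₁ tI₁ (sD₁.trans (hJ₁ _)) (tD₁.trans (hJ₁ _)) e1
  have f2 := eq_of_sdiff_sdiff_eq sI₂ tI₂ (sD₂.trans (hJ₂ _)) (tD₂.trans (hJ₂ _)) e3
  exact Prod.ext (Prod.ext f1 e2) (Prod.ext f2 e4)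

/-- **N vs L₁**: an N-image is never an L₁-image (the flat-1 parts would coincide, one overflowing, one not). -/
theorem N_ne_L₁ (F₁ : Finset α) (F₂ : Finset β) (s₁ s₂ : ℕ) (J₁ : Finset α → Finset α) (J₂ : Finset β → Finset β)
    (hJ₁ : ∀ X, J₁ X ⊆ X) (lo hi δ : ℕ)
    (RS : Finset ((Finset α × Finset α) × (Finset β × Finset β)))
    (hRS : ∀ σ : (Finset α × Finset α) × (Finset β × Finset β), σ ∈ RS ↔ σ.1.1 ⊆ F₁ ∧ σ.2.1 ⊆ F₂ ∧
      σ.1.2 ⊆ J₁ (F₁ \ σ.1.1) ∧ σ.2.2 ⊆ J₂ (F₂ \ σ.2.1) ∧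
      σ.1.2.card + σ.2.2.card = δ ∧ lo ≤ min σ.1.1.card s₁ + min σ.2.1.card s₂ ∧
      min σ.1.1.card s₁ + min σ.2.1.card s₂ ≤ hi ∧
      hi + δ + 1 ≤ min (F₁.card - σ.1.1.card) s₁ + min (F₂.card - σ.2.1.card) s₂)
    (φ₂ : Finset β → ℕ → ℕ → Finset β → Finset β)
    (σ τ : (Finset α × Finset α) × (Finset β × Finset β)) (hσ : σ ∈ RS) (hτ : τ ∈ RS)
    (s1 : ¬ (s₁ < min σ.1.1.card s₁ + σ.1.2.card)) (t1 : s₁ < min τ.1.1.card s₁ + τ.1.2.card) (h : (((F₁ \ σ.1.1) \ σ.1.2, σ.1.2), ((F₂ \ σ.2.1) \ σ.2.2, σ.2.2)) = (((F₁ \ τ.1.1) \ τ.1.2, τ.1.2), ((F₂ \ (φ₂ (F₂ \ τ.2.2) τ.2.1.card (τ.2.1.card + (min τ.1.1.card s₁ + τ.1.2.card - s₁)) τ.2.1)) \ τ.2.2, τ.2.2))) : False := by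
  obtain ⟨sI₁, sI₂, sD₁, sD₂, -, -, -, -⟩ := (hRS σ).1 hσ
  obtain ⟨tI₁, tI₂, tD₁, tD₂, -, -, -, -⟩ := (hRS τ).1 hτ
  simp only [Prod.mk.injEq] at h
  obtain ⟨⟨e1, e2⟩, -, -⟩ := h
  rw [← e2] at tD₁ e1
  have f1 := eq_of_sdiff_sdiff_eq sI₁ tI₁ (sD₁.trans (hJ₁ _)) (tD₁.trans (hJ₁ _)) e1
  rw [← f1, ← e2] at t1
  exact s1 t1

/-- **N vs L₂**, symmetric to `N_ne_L₁`. -/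
theorem N_ne_L₂ (F₁ : Finset α) (F₂ : Finset β) (s₁ s₂ : ℕ) (J₁ : Finset α → Finset α) (J₂ : Finset β → Finset β)
    (hJ₂ : ∀ X, J₂ X ⊆ X) (lo hi δ : ℕ)
    (RS : Finset ((Finset α × Finset α) × (Finset β × Finset β)))
    (hRS : ∀ σ : (Finset α × Finset α) × (Finset β × Finset β), σ ∈ RS ↔ σ.1.1 ⊆ F₁ ∧ σ.2.1 ⊆ F₂ ∧
      σ.1.2 ⊆ J₁ (F₁ \ σ.1.1) ∧ σ.2.2 ⊆ J₂ (F₂ \ σ.2.1) ∧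
      σ.1.2.card + σ.2.2.card = δ ∧ lo ≤ min σ.1.1.card s₁ + min σ.2.1.card s₂ ∧
      min σ.1.1.card s₁ + min σ.2.1.card s₂ ≤ hi ∧
      hi + δ + 1 ≤ min (F₁.card - σ.1.1.card) s₁ + min (F₂.card - σ.2.1.card) s₂)
    (φ₁ : Finset α → ℕ → ℕ → Finset α → Finset α)
    (σ τ : (Finset α × Finset α) × (Finset β × Finset β)) (hσ : σ ∈ RS) (hτ : τ ∈ RS)
    (s2 : ¬ (s₂ < min σ.2.1.card s₂ + σ.2.2.card)) (t2 : s₂ < min τ.2.1.card s₂ + τ.2.2.card) (h : (((F₁ \ σ.1.1) \ σ.1.2, σ.1.2), ((F₂ \ σ.2.1) \ σ.2.2, σ.2.2)) = (((F₁ \ (φ₁ (F₁ \ τ.1.2) τ.1.1.card (τ.1.1.card + (min τ.2.1.card s₂ + τ.2.2.card - s₂)) τ.1.1)) \ τ.1.2, τ.1.2), ((F₂ \ τ.2.1) \ τ.2.2, τ.2.2))) : False := by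
  obtain ⟨sI₁, sI₂, sD₁, sD₂, -, -, -, -⟩ := (hRS σ).1 hσ
  obtain ⟨tI₁, tI₂, tD₁, tD₂, -, -, -, -⟩ := (hRS τ).1 hτ
  simp only [Prod.mk.injEq] at h
  obtain ⟨-, ⟨e3, e4⟩⟩ := h
  rw [← e4] at tD₂ e3
  have f2 := eq_of_sdiff_sdiff_eq sI₂ tI₂ (sD₂.trans (hJ₂ _)) (tD₂.trans (hJ₂ _)) e3
  rw [← f2, ← e4] at t2
  exact s2 t2

/-- **S₁ vs L₁**: an S₁-image is never the L₁-image of a blocked source (its flat-1 part would not overflow). -/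
theorem S₁_ne_L₁ (F₁ : Finset α) (F₂ : Finset β) (s₁ s₂ : ℕ)
    (RS : Finset ((Finset α × Finset α) × (Finset β × Finset β)))
    (φ₂ : Finset β → ℕ → ℕ → Finset β → Finset β)
    (σ τ : (Finset α × Finset α) × (Finset β × Finset β))
    (s1 : s₁ < min σ.1.1.card s₁ + σ.1.2.card) (tb : ((((F₁ \ τ.1.1) \ τ.1.2, τ.1.2), (φ₂ (F₂ \ τ.2.2) τ.2.1.card (τ.2.1.card + (min τ.1.1.card s₁ + τ.1.2.card - min (F₁.card - τ.1.1.card) s₁)) τ.2.1, τ.2.2)) ∈ RS ∧ ¬ (s₁ < min ((F₁ \ τ.1.1) \ τ.1.2).card s₁ + τ.1.2.card) ∧ ¬ (s₂ < min (φ₂ (F₂ \ τ.2.2) τ.2.1.card (τ.2.1.card + (min τ.1.1.card s₁ + τ.1.2.card - min (F₁.card - τ.1.1.card) s₁)) τ.2.1).card s₂ + τ.2.2.card))) (h : ((σ.1.1, σ.1.2), ((F₂ \ (φ₂ (F₂ \ σ.2.2) σ.2.1.card (σ.2.1.card + (min σ.1.1.card s₁ + σ.1.2.card - min (F₁.card -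 σ.1.1.card) s₁)) σ.2.1)) \ σ.2.2, σ.2.2)) = (((F₁ \ τ.1.1) \ τ.1.2, τ.1.2), ((F₂ \ (φ₂ (F₂ \ τ.2.2) τ.2.1.card (τ.2.1.card + (min τ.1.1.card s₁ + τ.1.2.card - s₁)) τ.2.1)) \ τ.2.2, τ.2.2))) : False := by
  obtain ⟨-, tnov1, -⟩ := tb
  simp only [Prod.mk.injEq] at h
  obtain ⟨⟨e1, e2⟩, -, -⟩ := h
  rw [← e1, ← e2] at tnov1
  exact tnov1 s1

/-- **S₂ vs L₂**, symmetric to `S₁_ne_L₁`. -/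
theorem S₂_ne_L₂ (F₁ : Finset α) (F₂ : Finset β) (s₁ s₂ : ℕ)
    (RS : Finset ((Finset α × Finset α) × (Finset β × Finset β)))
    (φ₁ : Finset α → ℕ → ℕ → Finset α → Finset α)
    (σ τ : (Finset α × Finset α) × (Finset β × Finset β))
    (s2 : s₂ < min σ.2.1.card s₂ + σ.2.2.card) (tb : (((φ₁ (F₁ \ τ.1.2) τ.1.1.card (τ.1.1.card + (min τ.2.1.card s₂ + τ.2.2.card - min (F₂.card - τ.2.1.card) s₂)) τ.1.1, τ.1.2), ((F₂ \ τ.2.1) \ τ.2.2, τ.2.2)) ∈ RS ∧ ¬ (s₁ < min (φ₁ (F₁ \ τ.1.2) τ.1.1.card (τ.1.1.card + (min τ.2.1.card s₂ + τ.2.2.card - min (F₂.card - τ.2.1.card) s₂)) τ.1.1).card s₁ + τ.1.2.card) ∧ ¬ (s₂ < min ((F₂ \ τ.2.1) \ τ.2.2).card s₂ + τ.2.2.card))) (h : (((F₁ \ (φ₁ (F₁ \ σ.1.2) σ.1.1.card (σ.1.1.card + (min σ.2.1.card s₂ + σ.2.2.card - min (F₂.card - σ.2.1.card) s₂)) σ.1.1))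 \ σ.1.2, σ.1.2), (σ.2.1, σ.2.2)) = (((F₁ \ (φ₁ (F₁ \ τ.1.2) τ.1.1.card (τ.1.1.card + (min τ.2.1.card s₂ + τ.2.2.card - s₂)) τ.1.1)) \ τ.1.2, τ.1.2), ((F₂ \ τ.2.1) \ τ.2.2, τ.2.2))) : False := by
  obtain ⟨-, -, tnov2⟩ := tb
  simp only [Prod.mk.injEq] at h
  obtain ⟨-, ⟨e3, e4⟩⟩ := h
  rw [← e3, ← e4] at tnov2
  exact tnov2 s2


end TwoFlatPLD

end PercRepro
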